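/-
Copyright: cell `pub-ymgap` (HUMAN RULING D-0062), Track A of `YM-PLAN.md`, DAG node N20 (= NE7b); R134 acceleration seat
`pub-ymgap-dag-n20-c` (strategy s1, generation 6), module 34.  Released under the licence of the surrounding project.
-/
import Summits.QuantumFields.YangMills.Theorems.BalabanUVNodesN20LCSLabelTowerFidelity
import Literature.MathematicalPhysics.QuantumFieldTheory.Balaban1983to89.Node00.Record12MeasurabilityAbsolute
import Literature.MathematicalPhysics.QuantumFieldTheory.Balaban1983to89.Node00.Record12MeasurabilityAtRecord
import HarnessLib

/-!
# YM-DAG node N20 (= NE7b), strategy s1, module 34: THE LABEL TOWER AT THE RESIDUAL OF RECORD — modules 27–33 read at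
# `ζ := Node00.zeta316OfRecord A₁` (K0b's (3.16)·(3.20) fluctuation factor of print), where ALL THREE DISPLAYED LETTERS of the lineage
# (`IsZetaUnity ζ`, `IsZetaAbsLeOne ζ`, the (O4) joint measurability of the label weights) ARE THEOREMS OF THE TREE, so that the (α)-road's
# tower rows, mass identity, support semantics and fidelity certificate on Bałaban's label tower hold with NO law ∕ measurability hypothesis
# (the halves ∕ class bounds at the residual of record: module 35)

Track A of `YM-PLAN.md` (cell `pub-ymgap`, HUMAN RULING D-0062), node **N20** = spine estimate NE7b (`T4WeightBudget.RelWeightBound` — NOT PRINTED,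
NOT PROVED).  Seat `pub-ymgap-dag-n20-c` (R134, s1 «the `LocCondStability` INSTANCE for Bałaban's tower at a pinned 𝐑𝐓 step»), generation 6, module 34
(g5's modules 27–33 = `…N20LCSLabelTower*`).  Kernel theorems only: 0 `def`, 0 `sorry`, standard axioms; COUNT-NEUTRAL; `--supports` the K3⁗ item.
Nothing of Bałaban's is asserted.

WHY.  Modules 27–33 build Bałaban's T-step label tower `labelTowerOfRecord A₁ ζ` for an ARBITRARY residual fluctuation factor `ζ : ZetaOfRecord` and carry,
theorem by theorem, three displayed letters: `hζu : IsZetaUnity ζ` and `hζ : IsZetaAbsLeOne ζ` (def-T's two laws of the residual) and `hω` (n02-b's (O4):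
the label weights `ωOfRecord … A₁ ζ s t` jointly measurable in `(V′, U)` — def-R's (2.12) minimiser enters them).  AT THE RESIDUAL OF RECORD all three
are ALREADY THEOREMS of NODE 00's K0 lineage: K0b's `Node00/Record12Residuals` PINS the residual to print's (3.16)·(3.20) factor `zeta316OfRecord A₁` and
PROVES both laws (`isZetaUnity_zeta316OfRecord`, `isZetaAbsLeOne_zeta316OfRecord`); def-R's FILE 8 `Node00/Record12MeasurabilityAbsolute` PROVES (H-U)
`localBgMeasurable : LocalBgMeasurable F N ν` (the (2.16) local backgrounds over the (2.12) datum are measurable — a measurable minimiser selection);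
K0c's `Node00/Record12MeasurabilityAtRecord` gives (H-ζ) `zetaMeasurable_zeta316OfRecord_of_localBg`, and K0′-G3's `Node00/Record12Measurability` §3
`measurable_ωOfRecord_of_localBg` turns (H-U) ∧ (H-ζ) into (O4).  Nobody had composed them with the tower.  THIS FILE does, BY NAME: every row ∕ half ∕
identity ∕ support sentence ∕ fidelity certificate of modules 27–31, 33 read at `ζ := zeta316OfRecord F N ν M A₁` with the three letters struck; the
HALVES and CLASS BOUNDS (modules 28 §2–§4, 29 §3, 32) at the residual of record are module 35 (`…AtResidualOfRecordHalves`).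

WHAT (suffix `_rec` = «at the residual of record»; every proof is a specialisation of the cited module's theorem with the letters supplied).
* §1 THE LETTERS: `zetaMeasurable_rec` ((H-ζ), hypothesis-free), ★ **`measurable_ωOfRecord_rec`** (THE (O4) ROW of the label tower, hypothesis-free),
  `measurable_chiSeqOfRecord_rec` (the front factors, module 33's `hχ`), `labelChi_good_rec`, ★ `hstep_rec`, `integrable_labelChi_mul_eterm_rec`
  (module 27's rows, now modulo NOTHING).
* §2 module 28 ∕ 29 §1–§2 letter-free: `labelChi_eq_rec`, `hread_rec`, ★ `hunit_rec`, ★ `hpres_rec`, `hpres_eterm_rec`, ★★ **`sum_adm_integral_eterm_rec`**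
  (TOTAL MASS PRESERVED: `Σ_{h ∈ adm K′} ∫ eterm ρ₀ K′ h dμ_{K′} = ∫ ρ₀ dU₀` for every bounded measurable `ρ₀`, every `K′` — no hypothesis), ★ `integral_dens_rec`
  (the END record's `H2A` shape: `∫ dens ρ₀ K′ dμ_{K′} = ∫ ρ₀ dU₀`), ★ `hmod_rec`,
  `integral_eterm_eq_pullAlong_rec`.
* §3 SUPPORT SEMANTICS at the residual of record (module 31 letter-free + one new sentence): `chiSeq_eq_one_of_eterm_ne_zero_rec`, `chiFactor_of_eterm_ne_zero_rec`,
  ★ **`labelRS_of_eterm_ne_zero_rec`** — on the support of a history term the last label's (3.16)∕(3.20) pair has `S = R ⊆` the (3.16) range (K0b's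
  `zeta316OfRecord_eq_zero_of_not`: every other `(R, S)` weighs `0`).
* §4 FIDELITY letter-free: `integral_mul_eterm_succ_eq_integral_mul_labelPiece_rec`, ★ `rnDeriv_mul_eterm_succ_ae_eq_labelPiece_rec` (the label tower at the
  residual of record IS def-T's (†) label by label, Haar-a.e., modulo NOTHING but `k < K`).

HONEST FRAMING.  A RE-KEYING, not mathematics: the mathematics is def-R's (measurable minimiser selection), K0b's (the residual pinned to print and its laws)
and K0c's ∕ K0′-G3's (propagation); this file only composes.  BY-NAME EFFECT: on the OBJECT OF RECORD (Bałaban's T-steps with the (3.2)·(3.3)·(3.16)·(3.20)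
labels, residual = print's (3.16) factor) the (α)-road's rows `hstep` ∕ `hunit` ∕ `hpres` ∕ `hmod` ∕ `hint*` ∕ `hρ₀` and the mass identity hold UNCONDITIONALLY,
and (module 35) its two named `Prop`s are inhabited for (3.2)-pinned keys rooted at step 0 modulo ONLY the regularity letter `hreg`; for keys pinned at
levels `j ≥ 1` modulo `hreg` and «LCS-j».  What is NOT touched: «LCS-j» β-∕level-uniformly ((A1c), THE wall); the 𝐑-step (this tower is T-steps only); the key-pattern
READING (planners); `hreg` (K0's [Balaban1985Variational] Thm 1 facts, CONCORD range).  NE7b NOT PRINTED ∕ NOT PROVED; (α)-instance 0∕1; N20 NOT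
discharged; typed 28∕28, discharged count untouched; one finite four-torus at fixed `ε` — NOT ℝ⁴, NOT infinite volume, NOT OS, NOT a mass gap, NOT Clay.

References (LOCATORS; the cited objects carry their own tags in `Node00.*`): T. Bałaban, CMP 119 (1988) 243–285 [Balaban1988Convergent] ((2.12) p. 256,
(2.16) p. 257, (3.2)–(3.5) p. 265, (3.16) p. 268, (3.20)–(3.21) p. 269); CMP 122 (1989) 175–202 [Balaban1989LargeFieldI] ((0.3)–(0.4) p. 176, (1.22)–(1.28)
pp. 181–183); CMP 122 (1989) 355–392 [Balaban1989LargeFieldII] ((1.79)–(1.80) pp. 383–384); CMP 102 (1985) 277–309 [Balaban1985Variational] (Thm 1 p. 279).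
-/

set_option autoImplicit false

noncomputable section

open scoped BigOperators ENNReal

namespace Summit.QuantumFields.YangMills.BalabanUVNodes.N20LCSLabelTowerAtResidualOfRecord

open MeasureTheory
open Literature.MathematicalPhysics.QuantumFieldTheory.Balaban1983to89
open Literature.MathematicalPhysics.QuantumFieldTheory.Balaban1983to89.T4Continuum
open Literature.MathematicalPhysics.QuantumFieldTheory.Balaban1983to89.T4AveragingDisintegration (condLaw)
open Literature.MathematicalPhysics.QuantumFieldTheory.Balaban1983to89.B14.Eq218Concrete
open Literature.MathematicalPhysics.QuantumFieldTheory.Balaban1983to89.Node00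
open Summit.QuantumFields.BalabanUV.T4Continuum.B16HistoryIndexedRepr (GoodClass)
open Summit.QuantumFields.BalabanUV.T4Continuum.B16HistoryReprChain
open Summit.QuantumFields.BalabanUV.T4Continuum.NE7b.PrefixExtraction (admS)
open Summit.QuantumFields.BalabanUV.T4Continuum.NE7b.LocalConditionalStability (LocCondStability PointwiseExtraction)
open Summit.QuantumFields.YangMills.BalabanUVNodes.N20LCSLabelTower
open Summit.QuantumFields.YangMills.BalabanUVNodes.N20LCSLabelTowerClassWeight
open Summit.QuantumFields.YangMills.BalabanUVNodes.N20LCSLabelTowerByValue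
open Summit.QuantumFields.YangMills.BalabanUVNodes.N20LCSLabelTowerSupport
open Summit.QuantumFields.YangMills.BalabanUVNodes.N20LCSLabelTowerFidelity
open Summit.QuantumFields.YangMills.BalabanUVNodes.N20ByValueTelescoping (pullAlong)

variable (F : T4Family) (N : ℕ) [NeZero N] (ν : Stage7Numerics) (M : ℕ) (p : B12.RunParams) (g : ℕ → ℝ) (A₁ : ℝ)

/-! ## §1 The three letters at the residual of record, and module 27's rows modulo nothing -/

section Letters

/-- **(H-ζ) AT THE RESIDUAL OF RECORD, HYPOTHESIS-FREE**: K0b's fluctuation factor `zeta316OfRecord A₁` is jointly measurable in `(V′, U)` — K0c's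
`zetaMeasurable_zeta316OfRecord_of_localBg` at def-R's theorem `localBgMeasurable`. [folklore] -/
theorem zetaMeasurable_rec : ZetaMeasurable F N (zeta316OfRecord F N ν M A₁) :=
  zetaMeasurable_zeta316OfRecord_of_localBg (localBgMeasurable F N ν) M A₁

/-- ★ **THE (O4) ROW OF THE LABEL TOWER AT THE RESIDUAL OF RECORD, HYPOTHESIS-FREE**: every label weight `ωOfRecord … A₁ (zeta316OfRecord A₁) s t` is jointly
measurable in `(V′, U)` — K0′-G3's `measurable_ωOfRecord_of_localBg` at def-R's `localBgMeasurable` and §1's (H-ζ).  This is modules 27–33's binder `hω`,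
discharged. [folklore] -/
theorem measurable_ωOfRecord_rec (k : ℕ) (s : SeqOfRecord F ν M g p.K k) (t : LbOfRecord F ν p g k) :
    Measurable fun z : cfgOfRecord F N p.K (k + 1) × cfgOfRecord F N p.K k =>
      ωOfRecord F N ν M p g k A₁ (zeta316OfRecord F N ν M A₁) s t z.2 z.1 :=
  measurable_ωOfRecord_of_localBg (localBgMeasurable F N ν) M p g k A₁ (zetaMeasurable_rec F N ν M A₁) s t

/-- The front factors `χ_k(s)` of record are measurable at every level and sequence — K0′-G3's (P3) at def-R's `localBgMeasurable` (module 33's binder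
`hχ`, discharged). [folklore] -/
theorem measurable_chiSeqOfRecord_rec (K k : ℕ) (s : SeqOfRecord F ν M g K k) : Measurable (chiSeqOfRecord F N ν M g K k s) :=
  measurable_chiSeqOfRecord_of_localBg (localBgMeasurable F N ν) M g K k s

/-- The step kernel of the label tower at the residual of record is bounded measurable — module 27's `labelChi_good`, modulo nothing. [folklore] -/
theorem labelChi_good_rec (j : ℕ) (h : Fin j → LabelPat F ν p g) (q : LabelPat F ν p g) :
    (bddMeas (cfgOfRecord F N p.K j)).Gd (labelChi F N ν M p g A₁ (zeta316OfRecord F N ν M A₁) j h q) :=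
  labelChi_good F N ν M p g (measurable_ωOfRecord_rec F N ν M p g A₁) j h q

/-- ★ **`hstep` FOR THE LABEL TOWER AT THE RESIDUAL OF RECORD, MODULO NOTHING** (IR-102-1's per-(step, choice) integral identity, the shape of
`B16HistoryTowerExtractionStepDataLWR.hstep`): for every level `j`, history `h`, choice `q` and bounded measurable `f`,
`∫ (op j h q).T f dμ_{j+1} = ∫ labelChi j h q · f dμ_j`. [folklore] -/
theorem hstep_rec (j : ℕ) (h : Fin j → LabelPat F ν p g) (q : LabelPat F ν p g) (f : cfgOfRecord F N p.K j → ℝ)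
    (hf : (bddMeas (cfgOfRecord F N p.K j)).Gd f) :
    ∫ V', ((labelTowerOfRecord F N ν M p g A₁ (zeta316OfRecord F N ν M A₁)).op j h q).T f V' ∂(lawOfRecord F N p.K (j + 1)) =
      ∫ U, labelChi F N ν M p g A₁ (zeta316OfRecord F N ν M A₁) j h q U * f U ∂(lawOfRecord F N p.K j) :=
  hstep_labelTower F N ν M p g (measurable_ωOfRecord_rec F N ν M p g A₁) j h q f hf

/-- **`hintχ`** at the residual of record, modulo nothing: every `labelChi`-weighted history term of a bounded measurable `ρ₀` is integrable. [folklore] -/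
theorem integrable_labelChi_mul_eterm_rec {ρ₀ : cfgOfRecord F N p.K 0 → ℝ} (hρ : (bddMeas (cfgOfRecord F N p.K 0)).Gd ρ₀) (j : ℕ)
    (h : Fin j → LabelPat F ν p g) (q : LabelPat F ν p g) :
    Integrable (fun U => labelChi F N ν M p g A₁ (zeta316OfRecord F N ν M A₁) j h q U *
      (labelTowerOfRecord F N ν M p g A₁ (zeta316OfRecord F N ν M A₁)).eterm ρ₀ j h U) (lawOfRecord F N p.K j) :=
  integrable_labelChi_mul_eterm F N ν M p g (measurable_ωOfRecord_rec F N ν M p g A₁) hρ j h q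

/-- The operation of the label tower at the residual of record is the conditional expectation of `ω · f` given the block average (module 27's
`op_apply_eq_integral_condLaw`, modulo nothing; the clamp is the identity by the two laws, module 28's `clampW_ωOfRecord`). [folklore] -/
theorem op_apply_rec (j : ℕ) (h : Fin j → LabelPat F ν p g) (q : LabelPat F ν p g) (f : cfgOfRecord F N p.K j → ℝ)
    (V' : cfgOfRecord F N p.K (j + 1)) :
    ((labelTowerOfRecord F N ν M p g A₁ (zeta316OfRecord F N ν M A₁)).op j h q).T f V' =
      ∫ U, ωOfRecord F N ν M p g j A₁ (zeta316OfRecord F N ν M A₁) (seqOfHist F ν M p g j h) (labelAt F ν p g j q) U V' * f U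
        ∂(condLaw (lawOfRecord F N p.K j) (avOfRecord F N p.K j).avg V') := by
  rw [op_apply_eq_integral_condLaw F N ν M p g (measurable_ωOfRecord_rec F N ν M p g A₁)]
  exact integral_congr_ae (ae_of_all _ fun U => by
    show clampW _ * f U = _
    rw [clampW_ωOfRecord F N ν M p g A₁ (isZetaUnity_zeta316OfRecord A₁) (isZetaAbsLeOne_zeta316OfRecord A₁)])

end Letters

/-! ## §2 Modules 28 ∕ 29's identities, letter-free: `hread`, `hunit`, `hpres`, total mass, the module property, by-value weights -/

section Rows

/-- The step kernel IS the label weight on the graph, at the residual of record (module 28's `labelChi_eq`, letter-free). [folklore] -/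
theorem labelChi_eq_rec (j : ℕ) (h : Fin j → LabelPat F ν p g) (q : LabelPat F ν p g) (U : cfgOfRecord F N p.K j) :
    labelChi F N ν M p g A₁ (zeta316OfRecord F N ν M A₁) j h q U =
      ωOfRecord F N ν M p g j A₁ (zeta316OfRecord F N ν M A₁) (seqOfHist F ν M p g j h) (labelAt F ν p g j q) U ((avOfRecord F N p.K j).avg U) :=
  labelChi_eq F N ν M p g A₁ (isZetaUnity_zeta316OfRecord A₁) (isZetaAbsLeOne_zeta316OfRecord A₁) j h q U

/-- `hread` at the residual of record, letter-free (module 28's `hread_labelTower`). [folklore] -/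
theorem hread_rec [DecidableEq (LabelPat F ν p g)] (E : (j : ℕ) → (Fin j → LabelPat F ν p g) → Finset (LbOfRecord F ν p g j)) (j : ℕ)
    (h : Fin j → LabelPat F ν p g) (U : cfgOfRecord F N p.K j) :
    ∑ q ∈ (labelTowerOfRecord F N ν M p g A₁ (zeta316OfRecord F N ν M A₁)).branch j h ∩ labelPattern F ν p g E j h,
        labelChi F N ν M p g A₁ (zeta316OfRecord F N ν M A₁) j h q U =
      ∑ t ∈ E j h, ωOfRecord F N ν M p g j A₁ (zeta316OfRecord F N ν M A₁) (seqOfHist F ν M p g j h) t U ((avOfRecord F N p.K j).avg U) :=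
  hread_labelTower F N ν M p g A₁ (isZetaUnity_zeta316OfRecord A₁) (isZetaAbsLeOne_zeta316OfRecord A₁) E j h U

/-- ★ **`hunit` AT THE RESIDUAL OF RECORD, MODULO NOTHING** (IR-102-1's decomposition of unity over the admissible choices;
`B16HistoryTowerExtractionStepDataLWR.hunit`'s shape): `Σ_{q ∈ branch j h} labelChi j h q U = 1`. [folklore] -/
theorem hunit_rec (j : ℕ) (h : Fin j → LabelPat F ν p g) (U : cfgOfRecord F N p.K j) :
    ∑ q ∈ (labelTowerOfRecord F N ν M p g A₁ (zeta316OfRecord F N ν M A₁)).branch j h,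
      labelChi F N ν M p g A₁ (zeta316OfRecord F N ν M A₁) j h q U = 1 :=
  hunit_labelTower F N ν M p g A₁ (isZetaUnity_zeta316OfRecord A₁) (isZetaAbsLeOne_zeta316OfRecord A₁) j h U

/-- ★ **`hpres` AT THE RESIDUAL OF RECORD, MODULO NOTHING**: for every bounded measurable `f` of level `j`,
`Σ_{q ∈ branch j h} ∫ (op j h q).T f dμ_{j+1} = ∫ f dμ_j`. [folklore] -/
theorem hpres_rec (j : ℕ) (h : Fin j → LabelPat F ν p g) (f : cfgOfRecord F N p.K j → ℝ) (hf : (bddMeas (cfgOfRecord F N p.K j)).Gd f) :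
    ∑ q ∈ (labelTowerOfRecord F N ν M p g A₁ (zeta316OfRecord F N ν M A₁)).branch j h,
        ∫ V', ((labelTowerOfRecord F N ν M p g A₁ (zeta316OfRecord F N ν M A₁)).op j h q).T f V' ∂(lawOfRecord F N p.K (j + 1)) =
      ∫ U, f U ∂(lawOfRecord F N p.K j) :=
  hpres_labelTower F N ν M p g A₁ (isZetaUnity_zeta316OfRecord A₁) (isZetaAbsLeOne_zeta316OfRecord A₁) (measurable_ωOfRecord_rec F N ν M p g A₁)
    j h f hf

/-- `hpres` for history terms at the residual of record, modulo nothing (`PrefixExtractionLaws`' telescoping row). [folklore] -/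
theorem hpres_eterm_rec {ρ₀ : cfgOfRecord F N p.K 0 → ℝ} (hρ : (bddMeas (cfgOfRecord F N p.K 0)).Gd ρ₀) (j : ℕ) (h : Fin j → LabelPat F ν p g) :
    ∫ V', (∑ q ∈ (labelTowerOfRecord F N ν M p g A₁ (zeta316OfRecord F N ν M A₁)).branch j h,
        ((labelTowerOfRecord F N ν M p g A₁ (zeta316OfRecord F N ν M A₁)).op j h q).T
          ((labelTowerOfRecord F N ν M p g A₁ (zeta316OfRecord F N ν M A₁)).eterm ρ₀ j h) V') ∂(lawOfRecord F N p.K (j + 1)) =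
      ∫ U, (labelTowerOfRecord F N ν M p g A₁ (zeta316OfRecord F N ν M A₁)).eterm ρ₀ j h U ∂(lawOfRecord F N p.K j) :=
  hpres_labelTower_eterm F N ν M p g A₁ (isZetaUnity_zeta316OfRecord A₁) (isZetaAbsLeOne_zeta316OfRecord A₁)
    (measurable_ωOfRecord_rec F N ν M p g A₁) hρ j h

/-- ★★ **TOTAL MASS IS PRESERVED BY BAŁABAN's LABEL TOWER AT THE RESIDUAL OF RECORD — NO HYPOTHESIS** (the END record's `H2A` left side computed for
this tower; `B16HistoryReprInstance.sum_weight_eq`'s rows `hint` ∕ `hint′` ∕ `hpres` all theorems): for every bounded measurable `ρ₀` and every `K′`,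
`Σ_{h ∈ adm K′} ∫ eterm ρ₀ K′ h dμ_{K′} = ∫ ρ₀ dU₀` against the Haar field. [folklore] -/
theorem sum_adm_integral_eterm_rec {ρ₀ : cfgOfRecord F N p.K 0 → ℝ} (hρ : (bddMeas (cfgOfRecord F N p.K 0)).Gd ρ₀) (K' : ℕ) :
    ∑ h ∈ (labelTowerOfRecord F N ν M p g A₁ (zeta316OfRecord F N ν M A₁)).adm K',
        ∫ V, (labelTowerOfRecord F N ν M p g A₁ (zeta316OfRecord F N ν M A₁)).eterm ρ₀ K' h V ∂(lawOfRecord F N p.K K') =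
      ∫ U, ρ₀ U ∂(fieldMeasure (F.P p.K) 0 (SU N)) :=
  sum_adm_integral_eterm_labelTower F N ν M p g A₁ (isZetaUnity_zeta316OfRecord A₁) (isZetaAbsLeOne_zeta316OfRecord A₁)
    (measurable_ωOfRecord_rec F N ν M p g A₁) hρ K'

/-- ★ **THE LEVEL-`K′` DENSITY OF BAŁABAN's LABEL TOWER HAS THE MASS OF `ρ₀` — NO HYPOTHESIS** (the END record's `H2A` display
`∫ e^{t·obs}·ρ dU₀ = ∫ densFam T ρ₀ K t dμ_K` for this tower, once `ρ₀ K t := e^{t·obs}·ρ`; `B16HistoryReprChain.Tower.dens` = the sum of the history terms):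
`∫ dens ρ₀ K′ dμ_{K′} = ∫ ρ₀ dU₀` for every bounded measurable `ρ₀` and every `K′`. [folklore] -/
theorem integral_dens_rec {ρ₀ : cfgOfRecord F N p.K 0 → ℝ} (hρ : (bddMeas (cfgOfRecord F N p.K 0)).Gd ρ₀) (K' : ℕ) :
    ∫ V, (labelTowerOfRecord F N ν M p g A₁ (zeta316OfRecord F N ν M A₁)).dens ρ₀ K' V ∂(lawOfRecord F N p.K K') =
      ∫ U, ρ₀ U ∂(fieldMeasure (F.P p.K) 0 (SU N)) := by
  rw [← sum_adm_integral_eterm_rec F N ν M p g A₁ hρ K']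
  exact integral_finsetSum _ fun h _ => integrable_eterm F N ν M p g hρ K' h

/-- ★ **THE MODULE PROPERTY AT THE RESIDUAL OF RECORD, MODULO NOTHING** (n20-d's `hmod`, module 29): for bounded measurable `m` of level `j + 1` and `f`
of level `j`, `∫ m·(op j h q).T f dμ_{j+1} = ∫ (m ∘ avg_j)·(labelChi j h q·f) dμ_j`. [folklore] -/
theorem hmod_rec :
    ∀ (j : ℕ) (h : Fin j → LabelPat F ν p g) (q : LabelPat F ν p g),
      h ∈ (labelTowerOfRecord F N ν M p g A₁ (zeta316OfRecord F N ν M A₁)).adm j →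
      q ∈ (labelTowerOfRecord F N ν M p g A₁ (zeta316OfRecord F N ν M A₁)).branch j h →
      ∀ (m : cfgOfRecord F N p.K (j + 1) → ℝ) (f : cfgOfRecord F N p.K j → ℝ),
        (bddMeas (cfgOfRecord F N p.K (j + 1))).Gd m → (bddMeas (cfgOfRecord F N p.K j)).Gd f →
        ∫ x, m x * ((labelTowerOfRecord F N ν M p g A₁ (zeta316OfRecord F N ν M A₁)).op j h q).T f x ∂(lawOfRecord F N p.K (j + 1)) =
          ∫ y, m ((avOfRecord F N p.K j).avg y) * (labelChi F N ν M p g A₁ (zeta316OfRecord F N ν M A₁) j h q y * f y)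
            ∂(lawOfRecord F N p.K j) :=
  hmod_labelTower F N ν M p g (measurable_ωOfRecord_rec F N ν M p g A₁)

/-- The level-`K′` weight of a label history BY VALUE at the residual of record, modulo nothing (module 29's `integral_eterm_labelTower_eq_pullAlong`). [folklore] -/
theorem integral_eterm_eq_pullAlong_rec {ρ₀ : cfgOfRecord F N p.K 0 → ℝ} (hρ : (bddMeas (cfgOfRecord F N p.K 0)).Gd ρ₀) (K' : ℕ)
    (h : Fin K' → LabelPat F ν p g) (hh : h ∈ (labelTowerOfRecord F N ν M p g A₁ (zeta316OfRecord F N ν M A₁)).adm K') :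
    ∫ x, (labelTowerOfRecord F N ν M p g A₁ (zeta316OfRecord F N ν M A₁)).eterm ρ₀ K' h x ∂(lawOfRecord F N p.K K') =
      ∫ U, pullAlong (fun j => (avOfRecord F N p.K j).avg) (labelChi F N ν M p g A₁ (zeta316OfRecord F N ν M A₁)) K' h U * ρ₀ U
        ∂(fieldMeasure (F.P p.K) 0 (SU N)) :=
  integral_eterm_labelTower_eq_pullAlong F N ν M p g (measurable_ωOfRecord_rec F N ν M p g A₁) hρ K' h hh

end Rows

/-! ## §3 Support semantics at the residual of record -/

section Support

/-- On the support of a history term the history's small-field events hold: `eterm ρ₀ (k+1) h V′ ≠ 0 → χ_{k+1}(seqOfHist (k+1) h)(V′) = 1` — module 31's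
`chiSeq_eq_one_of_eterm_ne_zero` at the residual of record, modulo nothing. [folklore] -/
theorem chiSeq_eq_one_of_eterm_ne_zero_rec (ρ₀ : cfgOfRecord F N p.K 0 → ℝ) (k : ℕ) (h : Fin (k + 1) → LabelPat F ν p g)
    (V' : cfgOfRecord F N p.K (k + 1)) (hne : (labelTowerOfRecord F N ν M p g A₁ (zeta316OfRecord F N ν M A₁)).eterm ρ₀ (k + 1) h V' ≠ 0) :
    chiSeqOfRecord F N ν M g p.K (k + 1) (seqOfHist F ν M p g (k + 1) h) V' = 1 :=
  chiSeq_eq_one_of_eterm_ne_zero F N ν M p g (measurable_ωOfRecord_rec F N ν M p g A₁) ρ₀ k h V' hne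

/-- On the support of a history term the last label's (3.2) family is read off the new field: `P ⊆` the (3.2) range, the (3.2) factors are `1` off `P` and `0`
on `P` — module 31's `chiFactor_of_eterm_ne_zero` at the residual of record, letter-free. [folklore] -/
theorem chiFactor_of_eterm_ne_zero_rec (ρ₀ : cfgOfRecord F N p.K 0 → ℝ) (k : ℕ) (h : Fin (k + 1) → LabelPat F ν p g)
    (V' : cfgOfRecord F N p.K (k + 1)) (hne : (labelTowerOfRecord F N ν M p g A₁ (zeta316OfRecord F N ν M A₁)).eterm ρ₀ (k + 1) h V' ≠ 0) :
    (labelAt F ν p g k (h (Fin.last k))).1 ⊆ cubes32 F ν M p g k (seqOfHist F ν M p g k (Fin.init h)) ∧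
      (∀ c ∈ cubes32 F ν M p g k (seqOfHist F ν M p g k (Fin.init h)) \ (labelAt F ν p g k (h (Fin.last k))).1,
        chiFactor F N ν p g k c V' = 1) ∧
      (∀ c ∈ (labelAt F ν p g k (h (Fin.last k))).1, chiFactor F N ν p g k c V' = 0) :=
  chiFactor_of_eterm_ne_zero F N ν M p g A₁ (isZetaUnity_zeta316OfRecord A₁) (isZetaAbsLeOne_zeta316OfRecord A₁)
    (measurable_ωOfRecord_rec F N ν M p g A₁) ρ₀ k h V' hne

/-- ★ **THE (3.16)∕(3.20) LABELS ON THE SUPPORT OF A HISTORY TERM** (new at the residual of record): if `eterm ρ₀ (k+1) h V′ ≠ 0` then the last label's pair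
`(R, S)` has `S = R` and `R ⊆` the (3.16) range `cubes316 … P Q` of its own `(P, Q)` — every other pair weighs `0` under K0b's `zeta316OfRecord`
(`zeta316OfRecord_eq_zero_of_not`), so the term vanishes identically (module 31's `eterm_succ_eq_aWeight_mul`). [folklore] -/
theorem labelRS_of_eterm_ne_zero_rec (ρ₀ : cfgOfRecord F N p.K 0 → ℝ) (k : ℕ) (h : Fin (k + 1) → LabelPat F ν p g)
    (V' : cfgOfRecord F N p.K (k + 1)) (hne : (labelTowerOfRecord F N ν M p g A₁ (zeta316OfRecord F N ν M A₁)).eterm ρ₀ (k + 1) h V' ≠ 0) :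
    (labelAt F ν p g k (h (Fin.last k))).2.2.1 ⊆ cubes316 F ν M p g k (seqOfHist F ν M p g k (Fin.init h))
        (labelAt F ν p g k (h (Fin.last k))).1 (labelAt F ν p g k (h (Fin.last k))).2.1 ∧
      (labelAt F ν p g k (h (Fin.last k))).2.2.2 = (labelAt F ν p g k (h (Fin.last k))).2.2.1 := by
  by_contra hnot
  apply hne
  rw [eterm_succ_eq_aWeight_mul F N ν M p g A₁ (isZetaUnity_zeta316OfRecord A₁) (isZetaAbsLeOne_zeta316OfRecord A₁)
    (measurable_ωOfRecord_rec F N ν M p g A₁) ρ₀ k h V']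
  have hz : ∀ U : cfgOfRecord F N p.K k,
      zeta316OfRecord F N ν M A₁ p g k (seqOfHist F ν M p g k (Fin.init h)) (labelAt F ν p g k (h (Fin.last k))).1
        (labelAt F ν p g k (h (Fin.last k))).2.1 (labelAt F ν p g k (h (Fin.last k))).2.2 U V' = 0 := fun U =>
    zeta316OfRecord_eq_zero_of_not A₁ _ _ _ _ hnot U V'
  simp only [hz, mul_zero, zero_mul, integral_zero]

end Support

/-! ## §4 Fidelity at the residual of record, letter-free: the label tower IS def-T's (†), label by label -/

section Fidelity

/-- **ONE-STEP FIDELITY IN MEASURE at the residual of record, modulo only `k < K`** (module 33's `integral_mul_eterm_succ_eq_integral_mul_labelPiece` with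
the two laws, (O4) and `hχ` supplied). [folklore] -/
theorem integral_mul_eterm_succ_eq_integral_mul_labelPiece_rec {ρ₀ : cfgOfRecord F N p.K 0 → ℝ} (hρ : (bddMeas (cfgOfRecord F N p.K 0)).Gd ρ₀)
    (k : ℕ) (hk : k < p.K) (h : Fin k → LabelPat F ν p g) (t : LbOfRecord F ν p g k)
    {m : cfgOfRecord F N p.K (k + 1) → ℝ} (hm : (bddMeas (cfgOfRecord F N p.K (k + 1))).Gd m) :
    ∫ V', m V' * (labelTowerOfRecord F N ν M p g A₁ (zeta316OfRecord F N ν M A₁)).eterm ρ₀ (k + 1) (Fin.snoc h ⟨k, t⟩) V'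
        ∂(lawOfRecord F N p.K (k + 1)) =
      ∫ V', m V' * (chiSeqOfRecord F N ν M g p.K (k + 1) (σOfRecord F ν M p g k (seqOfHist F ν M p g k h) t) V' *
          texpASucc (avOfRecord F N p.K k).avg (chiSeqOfRecord F N ν M g p.K k)
            (fun _ U => ((lawOfRecord F N p.K k).rnDeriv (fieldMeasure (F.P p.K) k (SU N)) U).toReal *
              (labelTowerOfRecord F N ν M p g A₁ (zeta316OfRecord F N ν M A₁)).eterm ρ₀ k h U)
            (fun _ => ωOfRecord F N ν M p g k A₁ (zeta316OfRecord F N ν M A₁) (seqOfHist F ν M p g k h) t)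
            (σOfRecord F ν M p g k (seqOfHist F ν M p g k h) t) V')
        ∂(fieldMeasure (F.P p.K) (k + 1) (SU N)) :=
  integral_mul_eterm_succ_eq_integral_mul_labelPiece F N ν M p g A₁ (isZetaUnity_zeta316OfRecord A₁) (isZetaAbsLeOne_zeta316OfRecord A₁)
    (measurable_ωOfRecord_rec F N ν M p g A₁) hρ k hk h t (measurable_chiSeqOfRecord_rec F N ν M g p.K (k + 1) _) hm

/-- ★ **THE LABEL TOWER AT THE RESIDUAL OF RECORD IS def-T's (†), LABEL BY LABEL, Haar-a.e. — modulo only `k < K`** (module 33's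
`rnDeriv_mul_eterm_succ_ae_eq_labelPiece` with every letter supplied): `(dμ_{k+1}∕dHaar)·eterm (k+1) (h, t) = χ_{k+1}(σ s t)·texpASucc avg χ_k ((dμ_k∕dHaar)·eterm k h) ω(s,t) (σ s t)`
almost everywhere. [folklore] -/
theorem rnDeriv_mul_eterm_succ_ae_eq_labelPiece_rec {ρ₀ : cfgOfRecord F N p.K 0 → ℝ} (hρ : (bddMeas (cfgOfRecord F N p.K 0)).Gd ρ₀)
    (k : ℕ) (hk : k < p.K) (h : Fin k → LabelPat F ν p g) (t : LbOfRecord F ν p g k) :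
    (fun V' => ((lawOfRecord F N p.K (k + 1)).rnDeriv (fieldMeasure (F.P p.K) (k + 1) (SU N)) V').toReal *
        (labelTowerOfRecord F N ν M p g A₁ (zeta316OfRecord F N ν M A₁)).eterm ρ₀ (k + 1) (Fin.snoc h ⟨k, t⟩) V')
      =ᵐ[fieldMeasure (F.P p.K) (k + 1) (SU N)]
      fun V' => chiSeqOfRecord F N ν M g p.K (k + 1) (σOfRecord F ν M p g k (seqOfHist F ν M p g k h) t) V' *
          texpASucc (avOfRecord F N p.K k).avg (chiSeqOfRecord F N ν M g p.K k)
            (fun _ U => ((lawOfRecord F N p.K k).rnDeriv (fieldMeasure (F.P p.K) k (SU N)) U).toReal *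
              (labelTowerOfRecord F N ν M p g A₁ (zeta316OfRecord F N ν M A₁)).eterm ρ₀ k h U)
            (fun _ => ωOfRecord F N ν M p g k A₁ (zeta316OfRecord F N ν M A₁) (seqOfHist F ν M p g k h) t)
            (σOfRecord F ν M p g k (seqOfHist F ν M p g k h) t) V' :=
  rnDeriv_mul_eterm_succ_ae_eq_labelPiece F N ν M p g A₁ (isZetaUnity_zeta316OfRecord A₁) (isZetaAbsLeOne_zeta316OfRecord A₁)
    (measurable_ωOfRecord_rec F N ν M p g A₁) hρ k hk h t (measurable_chiSeqOfRecord_rec F N ν M g p.K (k + 1) _)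

end Fidelity

end Summit.QuantumFields.YangMills.BalabanUVNodes.N20LCSLabelTowerAtResidualOfRecord

end
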